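import Literature.MathematicalPhysics.QuantumLattice.HubbardUVSymbolJetsGevrey
import Literature.MathematicalPhysics.QuantumLattice.HubbardUVSymbolResummedBandJetsFactorial
import HarnessLib

/-!
# Gevrey-2 jets of the mismatch-resummed ultraviolet symbol along the frames with an `X`-FREE ratio:
# `‖Dⁿ Ψ̃(p)‖ ≤ X₀·|c|(6/Λ)·(n!)²·(2ρ)ⁿ`, `ρ = 8ρ₁(1 + (6/Λ)(Λ/128 + X₀δ))`, `ρ₁ = 4E_u(1 + 16(1+C_χ)/Λ) + F_v`

Topic `MathematicalPhysics/QuantumLattice`; the Gevrey-class companion of `HubbardUVSymbolResummedBandJetsFactorial` (same objects `Ψ̃ = w(ω,u)·R(u + w(ω,u)·v)`,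
same composition architecture).  Two improvements, both needed by the volume threshold of the K3 two-leg reading's aliasing channel (cell gate-hubbard-kl,
located risk «(C)-B-ALIAS-L» against the registered door `klEngL₄`): (i) the cutoff is read through a GEVREY-2 table `‖χ₂^{(l)}‖ ≤ X₀(l!)²C_χ^l`
(`HubbardUVSymbolJetsGevrey`, `Literature.Analysis.Calculus.IteratedDerivCompGevrey`), so the table's growth sits in the squared factorial and only `C_χ` enters
the ratio; (ii) the shifted band `φ = u + w(ω,u)·v` is fed to the composition lemma with the HONEST amplitude `B_φ = Λ/128 + X₀δ` (its first jets are of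
size `E_u ≪ 2ρ₁`), so the resolvent step costs `1 + (6/Λ)B_φ = 1 + 6/128 + 6X₀δ/Λ` per derivative instead of `1 + (6/Λ)(1+δX)`:

* `norm_iteratedFDeriv_weight_comp_le_gevrey` — `‖Dⁿ(w(ω,u ·))(p)‖ ≤ X₀·(n!)²·(4E_u(1+16(1+C_χ)/Λ))ⁿ`;
* `norm_iteratedFDeriv_shiftedBand_le_gevrey` — `‖Dⁿφ(p)‖ ≤ (Λ/128 + X₀δ)·(n!)²·(2ρ₁)ⁿ` (`1 ≤ n`);
* `norm_iteratedFDeriv_resolvent_comp_shiftedBand_le_gevrey` — on/above the shell `‖Dⁿ(R∘φ)(p)‖ ≤ |c|(6/Λ)·(n!)²·(8ρ₁(1+(6/Λ)(Λ/128+X₀δ)))ⁿ`;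
* **`norm_iteratedFDeriv_uvResummed_comp_le_gevrey`** — everywhere `‖DⁿΨ̃(p)‖ ≤ X₀·(|c|(6/Λ))·(n!)²·(2·8ρ₁(1+(6/Λ)(Λ/128+X₀δ)))ⁿ`.

Everything is proved; no definitions; no named facts.

## Sources

G. Benfatto, A. Giuliani, V. Mastropietro, Ann. Henri Poincaré 7 (2006) 809–898, §2.2 (2.23), (2.27)–(2.28), (2.36aa), §3 (3.2) [`BenfattoGiulianiMastropietro2006`].
-/

noncomputable section

namespace Literature.MathematicalPhysics.QuantumLattice

open Complex Finset Literature.Analysis.Calculus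
open scoped Nat

variable {c Λ ω : ℝ}

section Jets

variable {E : Type} [NormedAddCommGroup E] [NormedSpace ℝ E]

/-- **Weight along a band, Gevrey-2**: `‖Dⁿ(w(ω, u ·))(p)‖ ≤ X₀·(n!)²·(4E_u(1+16(1+C_χ)/Λ))ⁿ` for `‖Dⁱu(p)‖ ≤ i!·E_uⁱ` (`1 ≤ i ≤ n`).
[cite: BenfattoGiulianiMastropietro2006, §2.2 (2.36aa)] -/
theorem norm_iteratedFDeriv_weight_comp_le_gevrey (hΛ : 0 < Λ) (ω : ℝ) {n : ℕ} {X₀ Cχ : ℝ} (hX1 : 1 ≤ X₀) (hC : 0 ≤ Cχ)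
    (hX : ∀ l ≤ n, ∀ x : ℝ, ‖iteratedFDeriv ℝ l salmhoferCutoff x‖ ≤ X₀ * ((l ! : ℝ)) ^ 2 * Cχ ^ l) {u : E → ℝ} (hu : ContDiff ℝ (⊤ : ℕ∞) u)
    {Eu : ℝ} (hEu : 0 ≤ Eu) (p : E) (hDu : ∀ i, 1 ≤ i → i ≤ n → ‖iteratedFDeriv ℝ i u p‖ ≤ i ! * Eu ^ i) :
    ‖iteratedFDeriv ℝ n (fun q : E => uvWeightFn Λ ω (u q)) p‖ ≤ X₀ * ((n ! : ℝ)) ^ 2 * (4 * Eu * (1 + 16 * (1 + Cχ) / Λ * 1)) ^ n := by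
  have hcomp : (fun q : E => uvWeightFn Λ ω (u q)) = (fun t : ℝ => uvWeightFn Λ ω t) ∘ u := rfl
  rw [hcomp]
  have h := norm_iteratedFDeriv_comp_le_of_gevrey_two (F := ℝ) (G := ℝ) hu p (B := 1) (σ := Eu) (τ := 16 * (1 + Cχ) / Λ) zero_le_one hEu
    (by positivity) n
    (fun i hi1 hin => by
      refine (hDu i hi1 hin).trans ?_
      have h1 : (i ! : ℝ) ≤ ((i ! : ℝ)) ^ 2 := by
        rw [sq]; exact le_mul_of_one_le_left (by positivity) (by exact_mod_cast Nat.one_le_iff_ne_zero.2 (Nat.factorial_ne_zero i))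
      rw [one_mul]
      exact mul_le_mul_of_nonneg_right h1 (by positivity))
    (contDiff_uvWeightFn_band Λ ω) X₀ 0
    (fun k hk => by
      rw [add_zero]
      exact norm_iteratedFDeriv_uvWeightFn_band_le_gevrey hΛ ω hX1 hC (fun l hl x => hX l (hl.trans hk) x) (u p))
  simpa [add_zero] using h

/-- **The shifted band `φ = u + w(ω,u)·v`, Gevrey-2 with the honest amplitude**: for `1 ≤ n`, `‖Dⁿφ(p)‖ ≤ (Λ/128 + X₀δ)·(n!)²·(2ρ₁)ⁿ`,
`ρ₁ = 4E_u(1+16(1+C_χ)/Λ) + F_v` (`‖Dⁱu‖ ≤ i!·E_uⁱ` for `1 ≤ i`, `‖Dⁱv‖ ≤ δ·i!·F_vⁱ` for all `i ≤ n`; the `u`-term is `≤ (Λ/128)·(2ρ₁)ⁿ` because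
`E_u ≤ (Λ/128)·2ρ₁`). [cite: BenfattoGiulianiMastropietro2006, §2.2 (2.36aa)] -/
theorem norm_iteratedFDeriv_shiftedBand_le_gevrey (hΛ : 0 < Λ) (ω : ℝ) {n : ℕ} {X₀ Cχ : ℝ} (hX1 : 1 ≤ X₀) (hC : 0 ≤ Cχ)
    (hX : ∀ l ≤ n, ∀ x : ℝ, ‖iteratedFDeriv ℝ l salmhoferCutoff x‖ ≤ X₀ * ((l ! : ℝ)) ^ 2 * Cχ ^ l) {u v : E → ℝ} (hu : ContDiff ℝ (⊤ : ℕ∞) u)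
    (hv : ContDiff ℝ (⊤ : ℕ∞) v) {Eu Fv δ : ℝ} (hEu : 0 ≤ Eu) (hFv : 0 ≤ Fv) (hδ : 0 ≤ δ) (p : E)
    (hDu : ∀ i, 1 ≤ i → i ≤ n → ‖iteratedFDeriv ℝ i u p‖ ≤ i ! * Eu ^ i) (hDv : ∀ i ≤ n, ‖iteratedFDeriv ℝ i v p‖ ≤ δ * i ! * Fv ^ i)
    (hn : 1 ≤ n) :
    ‖iteratedFDeriv ℝ n (fun q : E => u q + uvWeightFn Λ ω (u q) * v q) p‖ ≤
      (Λ / 128 + X₀ * δ) * ((n ! : ℝ)) ^ 2 * (2 * (4 * Eu * (1 + 16 * (1 + Cχ) / Λ * 1) + Fv)) ^ n := by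
  have hX0 : 0 ≤ X₀ := zero_le_one.trans hX1
  set ρ₁ : ℝ := 4 * Eu * (1 + 16 * (1 + Cχ) / Λ * 1) + Fv with hρ₁
  have hpos4 : 0 ≤ 4 * Eu * (1 + 16 * (1 + Cχ) / Λ * 1) := by positivity
  have hρw : 4 * Eu * (1 + 16 * (1 + Cχ) / Λ * 1) ≤ ρ₁ := by rw [hρ₁]; linarith
  have hρv : Fv ≤ ρ₁ := by rw [hρ₁]; linarith
  have hρ0 : 0 ≤ ρ₁ := hFv.trans hρv
  have hw : ContDiff ℝ (⊤ : ℕ∞) (fun q : E => uvWeightFn Λ ω (u q)) := (contDiff_uvWeightFn_band Λ ω).comp hu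
  -- the product term: `X₀·δ·(n!)²·(2ρ₁)ⁿ`
  have hprod : ‖iteratedFDeriv ℝ n (fun q : E => uvWeightFn Λ ω (u q) * v q) p‖ ≤ X₀ * δ * ((n ! : ℝ)) ^ (max 2 1) * (2 * ρ₁) ^ n := by
    refine norm_iteratedFDeriv_mul_le_of_factorialPow (N := ((⊤ : ℕ∞) : WithTop ℕ∞)) hw hv (by exact_mod_cast le_top) p hX0 hδ hρ0 ?_ ?_
    · intro i hi
      refine (norm_iteratedFDeriv_weight_comp_le_gevrey hΛ ω hX1 hC (fun l hl x => hX l (hl.trans hi) x) hu hEu p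
        (fun j hj1 hj => hDu j hj1 (hj.trans hi))).trans ?_
      exact mul_le_mul_of_nonneg_left (pow_le_pow_left₀ (by positivity) hρw i) (by positivity)
    · intro i hi
      refine (hDv i hi).trans ?_
      rw [pow_one]
      exact mul_le_mul_of_nonneg_left (pow_le_pow_left₀ hFv hρv i) (by positivity)
  rw [show max 2 1 = 2 by norm_num] at hprod
  -- the `u` term: `n!·E_uⁿ ≤ (Λ/128)·(n!)²·(2ρ₁)ⁿ` since `E_u ≤ (Λ/128)·(2ρ₁)` and `E_u ≤ 2ρ₁`
  have hEuρ : Eu ≤ Λ / 128 * (2 * ρ₁) := by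
    have h1 : Λ / 128 * (2 * (4 * Eu * (1 + 16 * (1 + Cχ) / Λ * 1))) = Eu * (Λ / 16 + (1 + Cχ)) := by field_simp; ring
    have h2 : Λ / 128 * (2 * (4 * Eu * (1 + 16 * (1 + Cχ) / Λ * 1))) ≤ Λ / 128 * (2 * ρ₁) := by gcongr
    have h3 : Eu ≤ Eu * (Λ / 16 + (1 + Cχ)) := le_mul_of_one_le_right hEu (by nlinarith)
    linarith [h1 ▸ h2]
  have hEu2ρ : Eu ≤ 2 * ρ₁ := by
    have : Eu ≤ 4 * Eu * (1 + 16 * (1 + Cχ) / Λ * 1) := by nlinarith [show (0 : ℝ) ≤ 16 * (1 + Cχ) / Λ by positivity]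
    linarith
  have hu_term : ‖iteratedFDeriv ℝ n u p‖ ≤ Λ / 128 * ((n ! : ℝ)) ^ 2 * (2 * ρ₁) ^ n := by
    refine (hDu n hn le_rfl).trans ?_
    obtain ⟨k, rfl⟩ : ∃ k, n = k + 1 := ⟨n - 1, by omega⟩
    have hfac : (1 : ℝ) ≤ (k + 1) ! := by exact_mod_cast Nat.one_le_iff_ne_zero.2 (Nat.factorial_ne_zero _)
    calc ((k + 1) ! : ℝ) * Eu ^ (k + 1) = (k + 1) ! * (Eu ^ k * Eu) := by rw [pow_succ]
      _ ≤ (k + 1) ! * ((2 * ρ₁) ^ k * (Λ / 128 * (2 * ρ₁))) := by gcongr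
      _ = Λ / 128 * ((k + 1) ! : ℝ) * (2 * ρ₁) ^ (k + 1) := by rw [pow_succ]; ring
      _ ≤ Λ / 128 * ((k + 1) ! : ℝ) ^ 2 * (2 * ρ₁) ^ (k + 1) := by
          rw [sq]; gcongr; exact le_mul_of_one_le_left (by positivity) hfac
  have hnN : ((n : ℕ∞) : WithTop ℕ∞) ≤ ((⊤ : ℕ∞) : WithTop ℕ∞) := by exact_mod_cast le_top
  rw [fun_iteratedFDeriv_add_apply (hu.contDiffAt.of_le hnN) ((hw.mul hv).contDiffAt.of_le hnN)]
  refine (norm_add_le _ _).trans ?_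
  calc ‖iteratedFDeriv ℝ n u p‖ + ‖iteratedFDeriv ℝ n (fun q : E => uvWeightFn Λ ω (u q) * v q) p‖
      ≤ Λ / 128 * ((n ! : ℝ)) ^ 2 * (2 * ρ₁) ^ n + X₀ * δ * ((n ! : ℝ)) ^ 2 * (2 * ρ₁) ^ n := add_le_add hu_term hprod
    _ = (Λ / 128 + X₀ * δ) * ((n ! : ℝ)) ^ 2 * (2 * ρ₁) ^ n := by ring

/-- **The resolvent composed with the shifted band, Gevrey-2, on and above the shell**: with `|v(p)| ≤ δ ≤ Λ/4`, `Λ²/4 ≤ ω² + u(p)²`: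
`‖Dⁿ(R ∘ φ)(p)‖ ≤ |c|(6/Λ)·(n!)²·(4·(2ρ₁)·(1 + (6/Λ)(Λ/128 + X₀δ)))ⁿ`. [cite: BenfattoGiulianiMastropietro2006, §2.2 (2.27)–(2.28)] -/
theorem norm_iteratedFDeriv_resolvent_comp_shiftedBand_le_gevrey (hΛ : 0 < Λ) (hω : ω ≠ 0) {n : ℕ} {X₀ Cχ : ℝ} (hX1 : 1 ≤ X₀) (hC : 0 ≤ Cχ)
    (hX : ∀ l ≤ n, ∀ x : ℝ, ‖iteratedFDeriv ℝ l salmhoferCutoff x‖ ≤ X₀ * ((l ! : ℝ)) ^ 2 * Cχ ^ l) {u v : E → ℝ} (hu : ContDiff ℝ (⊤ : ℕ∞) u)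
    (hv : ContDiff ℝ (⊤ : ℕ∞) v) {Eu Fv δ : ℝ} (hEu : 0 ≤ Eu) (hFv : 0 ≤ Fv) (hδ : 0 ≤ δ) (hδΛ : δ ≤ Λ / 4) (p : E) (hvp : |v p| ≤ δ)
    (hshell : Λ ^ 2 / 4 ≤ ω ^ 2 + u p ^ 2)
    (hDu : ∀ i, 1 ≤ i → i ≤ n → ‖iteratedFDeriv ℝ i u p‖ ≤ i ! * Eu ^ i) (hDv : ∀ i ≤ n, ‖iteratedFDeriv ℝ i v p‖ ≤ δ * i ! * Fv ^ i) :
    ‖iteratedFDeriv ℝ n (fun q : E => resolventFnXi c 0 ω (u q + uvWeightFn Λ ω (u q) * v q)) p‖ ≤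
      |c| * (6 / Λ) * ((n ! : ℝ)) ^ 2 * (4 * (2 * (4 * Eu * (1 + 16 * (1 + Cχ) / Λ * 1) + Fv)) * (1 + 6 / Λ * (Λ / 128 + X₀ * δ))) ^ n := by
  have hω0 : ω + 0 ≠ 0 := by rwa [add_zero]
  have hX0 : 0 ≤ X₀ := zero_le_one.trans hX1
  have hφ : ContDiff ℝ (⊤ : ℕ∞) (fun q : E => u q + uvWeightFn Λ ω (u q) * v q) := hu.add (((contDiff_uvWeightFn_band Λ ω).comp hu).mul hv)
  have hcomp : (fun q : E => resolventFnXi c 0 ω (u q + uvWeightFn Λ ω (u q) * v q)) =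
      resolventFnXi c 0 ω ∘ (fun q : E => u q + uvWeightFn Λ ω (u q) * v q) := rfl
  rw [hcomp]
  have hden : Λ / 6 ≤ ‖-I * ((ω + 0 : ℝ) : ℂ) + ((u p + uvWeightFn Λ ω (u p) * v p : ℝ) : ℂ)‖ :=
    norm_shiftDen_resummed_ge hΛ hshell (abs_uvWeightFn_le_one Λ ω (u p)) (hvp.trans hδΛ)
  have h6Λ : 0 < Λ / 6 := by positivity
  have h := norm_iteratedFDeriv_comp_le_of_gevrey_two (F := ℝ) (G := ℂ) hφ p (B := Λ / 128 + X₀ * δ)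
    (σ := 2 * (4 * Eu * (1 + 16 * (1 + Cχ) / Λ * 1) + Fv)) (τ := 6 / Λ) (by positivity) (by positivity) (by positivity) n
    (fun i hi1 hin => norm_iteratedFDeriv_shiftedBand_le_gevrey hΛ ω hX1 hC (fun l hl x => hX l (hl.trans hin) x) hu hv hEu hFv hδ p
      (fun j hj1 hj => hDu j hj1 (hj.trans hin)) (fun j hj => hDv j (hj.trans hin)) hi1)
    (contDiff_resolventFnXi (c := c) hω0) (|c| * (6 / Λ)) 0
    (fun k hk => by
      rw [add_zero, norm_iteratedFDeriv_eq_norm_iteratedDeriv, norm_iteratedDeriv_resolventFnXi hω0]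
      have h1 : (Λ / 6) ^ (k + 1) ≤ ‖-I * ((ω + 0 : ℝ) : ℂ) + ((u p + uvWeightFn Λ ω (u p) * v p : ℝ) : ℂ)‖ ^ (k + 1) :=
        pow_le_pow_left₀ h6Λ.le hden _
      have hfac : (k ! : ℝ) ≤ ((k ! : ℝ)) ^ 2 := by
        rw [sq]; exact le_mul_of_one_le_left (by positivity) (by exact_mod_cast Nat.one_le_iff_ne_zero.2 (Nat.factorial_ne_zero k))
      calc |c| * (k ! : ℝ) / ‖-I * ((ω + 0 : ℝ) : ℂ) + ((u p + uvWeightFn Λ ω (u p) * v p : ℝ) : ℂ)‖ ^ (k + 1)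
          ≤ |c| * (k ! : ℝ) / (Λ / 6) ^ (k + 1) := div_le_div_of_nonneg_left (by positivity) (by positivity) h1
        _ = |c| * (6 / Λ) * k ! * (6 / Λ) ^ k := by rw [div_eq_mul_inv, ← inv_pow, inv_div, pow_succ]; ring
        _ ≤ |c| * (6 / Λ) * ((k ! : ℝ)) ^ 2 * (6 / Λ) ^ k := by gcongr)
  simpa [add_zero] using h

/-- **GEVREY-2 JETS OF THE RESUMMED SYMBOL ALONG THE FRAMES, `X`-FREE RATIO.**  `0 < Λ`, `ω ≠ 0`, Gevrey table `‖χ₂^{(l)}‖ ≤ X₀(l!)²C_χ^l`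
(`l ≤ n`, `1 ≤ X₀`, `0 ≤ C_χ`), bands `‖Dⁱu(p)‖ ≤ i!·E_uⁱ` (`1 ≤ i ≤ n`), `‖Dⁱv(p)‖ ≤ δ·i!·F_vⁱ` (`i ≤ n`), `|v(p)| ≤ δ ≤ Λ/4`.  With
`ρ₁ = 4E_u(1+16(1+C_χ)/Λ) + F_v`, `ρ = 4(2ρ₁)(1 + (6/Λ)(Λ/128 + X₀δ))`:
`‖Dⁿ[q ↦ w(ω,u q)·resolventFnXi c 0 ω (u q + w(ω,u q)·v q)](p)‖ ≤ X₀·(|c|(6/Λ))·(n!)²·(2ρ)ⁿ`. [cite: BenfattoGiulianiMastropietro2006, §2.2 (2.36aa)] -/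
theorem norm_iteratedFDeriv_uvResummed_comp_le_gevrey (hΛ : 0 < Λ) (hω : ω ≠ 0) {n : ℕ} {X₀ Cχ : ℝ} (hX1 : 1 ≤ X₀) (hC : 0 ≤ Cχ)
    (hX : ∀ l ≤ n, ∀ x : ℝ, ‖iteratedFDeriv ℝ l salmhoferCutoff x‖ ≤ X₀ * ((l ! : ℝ)) ^ 2 * Cχ ^ l) {u v : E → ℝ} (hu : ContDiff ℝ (⊤ : ℕ∞) u)
    (hv : ContDiff ℝ (⊤ : ℕ∞) v) {Eu Fv δ : ℝ} (hEu : 0 ≤ Eu) (hFv : 0 ≤ Fv) (hδ : 0 ≤ δ) (hδΛ : δ ≤ Λ / 4) (p : E) (hvp : |v p| ≤ δ)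
    (hDu : ∀ i, 1 ≤ i → i ≤ n → ‖iteratedFDeriv ℝ i u p‖ ≤ i ! * Eu ^ i) (hDv : ∀ i ≤ n, ‖iteratedFDeriv ℝ i v p‖ ≤ δ * i ! * Fv ^ i) :
    ‖iteratedFDeriv ℝ n (fun q : E => ((uvWeightFn Λ ω (u q) : ℝ) : ℂ) * resolventFnXi c 0 ω (u q + uvWeightFn Λ ω (u q) * v q)) p‖ ≤
      X₀ * (|c| * (6 / Λ)) * ((n ! : ℝ)) ^ 2 *
        (2 * (4 * (2 * (4 * Eu * (1 + 16 * (1 + Cχ) / Λ * 1) + Fv)) * (1 + 6 / Λ * (Λ / 128 + X₀ * δ)))) ^ n := by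
  have hω0 : ω + 0 ≠ 0 := by rwa [add_zero]
  have hX0 : 0 ≤ X₀ := zero_le_one.trans hX1
  set ρw : ℝ := 4 * Eu * (1 + 16 * (1 + Cχ) / Λ * 1) with hρw
  set ρ₁ : ℝ := ρw + Fv with hρ₁
  set ρ : ℝ := 4 * (2 * ρ₁) * (1 + 6 / Λ * (Λ / 128 + X₀ * δ)) with hρ
  have hρw0 : 0 ≤ ρw := by rw [hρw]; positivity
  have hρ₁0 : 0 ≤ ρ₁ := by rw [hρ₁]; positivity
  have hρ0 : 0 ≤ ρ := by rw [hρ]; positivity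
  have hRHS0 : 0 ≤ X₀ * (|c| * (6 / Λ)) * ((n ! : ℝ)) ^ 2 * (2 * ρ) ^ n := by positivity
  have hwR : ContDiff ℝ (⊤ : ℕ∞) (fun q : E => uvWeightFn Λ ω (u q)) := (contDiff_uvWeightFn_band Λ ω).comp hu
  have hwC : ContDiff ℝ (⊤ : ℕ∞) (fun q : E => ((uvWeightFn Λ ω (u q) : ℝ) : ℂ)) := Complex.ofRealCLM.contDiff.comp hwR
  have hRφ : ContDiff ℝ (⊤ : ℕ∞) (fun q : E => resolventFnXi c 0 ω (u q + uvWeightFn Λ ω (u q) * v q)) :=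
    (contDiff_resolventFnXi (c := c) hω0).comp (hu.add (hwR.mul hv))
  by_cases hshell : ω ^ 2 + u p ^ 2 < Λ ^ 2 / 4
  · have hopen : ∀ᶠ q in nhds p, ω ^ 2 + u q ^ 2 < Λ ^ 2 / 4 :=
      (continuous_const.add ((hu.continuous).pow 2)).continuousAt.eventually (gt_mem_nhds hshell)
    have hev : (fun q : E => ((uvWeightFn Λ ω (u q) : ℝ) : ℂ) * resolventFnXi c 0 ω (u q + uvWeightFn Λ ω (u q) * v q)) =ᶠ[nhds p]
        fun _ => (0 : ℂ) := by
      filter_upwards [hopen] with q hq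
      have hw0 : uvWeightFn Λ ω (u q) = 0 := (uvWeightFn_eq_zero_of_lt hΛ (e := ω) (ω := u q) (by linarith)).1
      rw [hw0, Complex.ofReal_zero, zero_mul]
    rw [(hev.iteratedFDeriv ℝ n).eq_of_nhds]
    rcases Nat.eq_zero_or_pos n with hn | hn
    · subst hn; simpa using hRHS0
    · rw [iteratedFDeriv_const_of_ne (Nat.pos_iff_ne_zero.1 hn)]
      simpa using hRHS0
  · have hge : Λ ^ 2 / 4 ≤ ω ^ 2 + u p ^ 2 := not_lt.1 hshell
    have hρwρ : ρw ≤ ρ := by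
      have h1 : ρw ≤ ρ₁ := by rw [hρ₁]; linarith
      have h2 : ρ₁ ≤ 4 * (2 * ρ₁) * (1 + 6 / Λ * (Λ / 128 + X₀ * δ)) := by
        have : 1 ≤ 4 * 2 * (1 + 6 / Λ * (Λ / 128 + X₀ * δ)) := by
          have : 0 ≤ 6 / Λ * (Λ / 128 + X₀ * δ) := by positivity
          linarith
        nlinarith
      rw [hρ]; linarith
    have hW : ∀ i ≤ n, ‖iteratedFDeriv ℝ i (fun q : E => ((uvWeightFn Λ ω (u q) : ℝ) : ℂ)) p‖ ≤ X₀ * ((i ! : ℝ)) ^ 2 * ρ ^ i := by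
      intro i hi
      have hcast : (fun q : E => ((uvWeightFn Λ ω (u q) : ℝ) : ℂ)) = Complex.ofRealLI ∘ (fun q : E => uvWeightFn Λ ω (u q)) := rfl
      rw [hcast, Complex.ofRealLI.norm_iteratedFDeriv_comp_left ((hwR.of_le (by exact_mod_cast le_top : ((i : ℕ∞) : WithTop ℕ∞) ≤ _)).contDiffAt) le_rfl]
      refine (norm_iteratedFDeriv_weight_comp_le_gevrey hΛ ω hX1 hC (fun l hl x => hX l (hl.trans hi) x) hu hEu p
        (fun j hj1 hj => hDu j hj1 (hj.trans hi))).trans ?_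
      exact mul_le_mul_of_nonneg_left (pow_le_pow_left₀ hρw0 hρwρ i) (by positivity)
    have hR : ∀ i ≤ n, ‖iteratedFDeriv ℝ i (fun q : E => resolventFnXi c 0 ω (u q + uvWeightFn Λ ω (u q) * v q)) p‖ ≤
        |c| * (6 / Λ) * ((i ! : ℝ)) ^ 2 * ρ ^ i := fun i hi =>
      norm_iteratedFDeriv_resolvent_comp_shiftedBand_le_gevrey hΛ hω hX1 hC (fun l hl x => hX l (hl.trans hi) x) hu hv hEu hFv hδ hδΛ p hvp hge
        (fun j hj1 hj => hDu j hj1 (hj.trans hi)) (fun j hj => hDv j (hj.trans hi))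
    have h := norm_iteratedFDeriv_mul_le_of_factorialPow (N := ((⊤ : ℕ∞) : WithTop ℕ∞)) (a := 2) (b := 2) hwC hRφ (by exact_mod_cast le_top) p hX0
      (by positivity) hρ0 hW hR
    rw [max_self] at h
    exact h

end Jets

end Literature.MathematicalPhysics.QuantumLattice

end
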